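import Summits.QuantumFields.YangMills.Theorems.BalabanLadderIROddTorusChessboard
import Summits.QuantumFields.YangMills.Theorems.DirichletWindowAllSidesChessboardTwistedOdd
import HarnessLib

/-!
# The chessboard estimate for plaquette sets of ALL orientations on the odd torus — families and the functional

Support file for item stmt-QuantumFields-20194 (`DirichletWindow.AllSidesCouplingChessboard`, K1 of the large-field
sparsity line; seat ym-dw-p1 g3).

The tree's odd-torus chessboard `OddTorusChessboard.wilsonExpectation_expObs_le_rpow_orient` bounds the Chebyshev
functional `⟨exp(c ∑_{q ∈ P} φ_q)⟩_{Λ,β}` (`φ_q = N - Re tr ρ U_q`, `0 ≤ c ≤ β`, `L` odd, `L ≥ 3`) for plaquette sets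
`P` of ONE orientation.  Mixed orientations cannot be reached from it by Hölder's inequality over the `d(d-1)/2`
orientations (the coupling constraint `c ≤ β` caps the Hölder exponent).  Here the estimate is proved for an
ARBITRARY finite set of plaquettes,

  `⟨exp(c ∑_{q ∈ P} φ_q)⟩_{Λ,β} ≤ ⟨exp(c ∑_{all q} φ_q)⟩_{Λ,β} ^ (#P / L^d)`
  (`wilsonExpectation_expObs_le_rpow_all_odd`),

by the TWISTED two-class maximisation argument `AllSidesChessboard.twisted_chessboard_le_rpow_odd`: a plaquette set is
a family `A = (A_o)_o` of block patterns, one per orientation (dictionary `toPlaq o`, in-plane rows shifted by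
`S+1`), and the single weighted Osterwalder–Seiler Cauchy–Schwarz inequality of the axis `k`
(`sq_wilsonExpectation_mul_timeReflect_mul_expObs_le`, cut AND shared plaquettes weighted at once) symmetrises the
orientations transverse to `k` in the closed positive half-line (`csymP k`) and the orientations containing `k` in
the closed negative one (`symM k 1`) — the twisted inequality `mpsi_sq_le`.  Exponent: `#P / L^d` with `L^d` the
number of plaquettes of ONE orientation, as in the one-orientation estimate.

HONEST FRAMING: finite-torus reflection-positivity bookkeeping over tree theorems; nothing here is a statement about
the Yang–Mills mass gap or about infinite volume.  References: Fröhlich–Israel–Lieb–Simon, CMP 62 (1978) Thm. 4.1;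
Fröhlich–Lieb, CMP 60 (1978) Thm. 2.2/2.3; Osterwalder–Seiler, Ann. Phys. 110 (1978) §2; Seiler LNP 159 Ch. 2.
-/

noncomputable section

open MeasureTheory Finset
open Literature.MathematicalPhysics.QuantumFieldTheory
open Literature.MathematicalPhysics.QuantumFieldTheory.WilsonRP
open Literature.MathematicalPhysics.QuantumFieldTheory.WilsonOddRP
open Literature.Barriers.CriticalPhenomena.NonGibbs
open Literature.Probability.LatticeModels
open Summit.QuantumFields.YangMills.Theorems.SoloBlind
open Summit.QuantumFields.YangMills.Theorems.OddTorusChessboard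

namespace Summit.QuantumFields.YangMills.Theorems.AllSidesChessboard

variable {d L N : ℕ} [NeZero d] [NeZero L] {G : Type*} [Group G] [TopologicalSpace G]
  [IsTopologicalGroup G] [CompactSpace G] [MeasurableSpace G] [BorelSpace G]
  (ρ : G →* Matrix (Fin N) (Fin N) ℂ)

/-! ### §1. Families of patterns and their plaquette sets -/

section Plaqs

/-- The set of plaquettes labelled by a family of block patterns, one pattern per orientation. -/
def plaqs (A : Orient d → Finset (BlockIdx d L)) : Finset (Plaquette d L) :=
  univ.biUnion fun o => (A o).image (toPlaq o)

omit [NeZero d] [NeZero L] in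
/-- Membership in `plaqs`. -/
theorem mem_plaqs {A : Orient d → Finset (BlockIdx d L)} {q : Plaquette d L} :
    q ∈ plaqs A ↔ ∃ c ∈ A q.2, toPlaq q.2 c = q := by
  rw [plaqs, mem_biUnion]
  constructor
  · rintro ⟨o, -, h⟩
    obtain ⟨c, hc, rfl⟩ := mem_image.1 h
    exact ⟨c, hc, rfl⟩
  · rintro ⟨c, hc, hq⟩
    exact ⟨q.2, mem_univ _, mem_image.2 ⟨c, hc, hq⟩⟩

omit [NeZero d] [NeZero L] in
/-- `plaqs` of a componentwise union. -/
theorem plaqs_union (X Y : Orient d → Finset (BlockIdx d L)) :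
    plaqs (fun o => X o ∪ Y o) = plaqs X ∪ plaqs Y := by
  ext q
  simp only [mem_plaqs, mem_union]
  constructor
  · rintro ⟨c, hc | hc, hq⟩
    · exact Or.inl ⟨c, hc, hq⟩
    · exact Or.inr ⟨c, hc, hq⟩
  · rintro (⟨c, hc, hq⟩ | ⟨c, hc, hq⟩)
    · exact ⟨c, Or.inl hc, hq⟩
    · exact ⟨c, Or.inr hc, hq⟩

omit [NeZero d] [NeZero L] in
/-- `plaqs` of a triple componentwise union. -/
theorem plaqs_union₃ (X F Y : Orient d → Finset (BlockIdx d L)) :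
    plaqs (fun o => X o ∪ F o ∪ Y o) = plaqs X ∪ plaqs F ∪ plaqs Y := by
  rw [← plaqs_union, ← plaqs_union]

omit [NeZero d] [NeZero L] in
/-- Componentwise disjoint families have disjoint plaquette sets. -/
theorem disjoint_plaqs {X Y : Orient d → Finset (BlockIdx d L)} (h : ∀ o, Disjoint (X o) (Y o)) :
    Disjoint (plaqs X) (plaqs Y) := by
  rw [Finset.disjoint_left]
  intro q hX hY
  obtain ⟨c, hc, hq⟩ := mem_plaqs.1 hX
  obtain ⟨c', hc', hq'⟩ := mem_plaqs.1 hY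
  have : c = c' := toPlaq_injective q.2 (hq.trans hq'.symm)
  subst this
  exact Finset.disjoint_left.1 (h q.2) hc hc'

omit [NeZero L] in
/-- The plaquette set of the reflected family is the reflected plaquette set (odd torus, axis `0`). -/
theorem plaqs_reflect (hL : Odd L) (X : Orient d → Finset (BlockIdx d L)) :
    plaqs (fun o => (X o).image (cellReflect 0 1)) = (plaqs X).image plaqReflect := by
  rw [plaqs, plaqs, biUnion_image]
  exact biUnion_congr rfl fun o _ => image_toPlaq_image_cellReflect_zero hL o (X o)

omit [NeZero d] [NeZero L] in
/-- The plaquette set of the translated family is the translated plaquette set. -/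
theorem plaqs_translate (k : Fin d) (a : ZMod L) (A : Orient d → Finset (BlockIdx d L)) :
    plaqs (fun o => (A o).image (cellTranslate k a)) = plaqTranslate (Pi.single k a) (plaqs A) := by
  rw [plaqs, plaqs, plaqTranslate, biUnion_image]
  refine biUnion_congr rfl fun o _ => ?_
  rw [image_toPlaq_image_cellTranslate, plaqTranslate]

omit [NeZero L] in
/-- `oSwap k` is an involution on orientations. -/
theorem oSwap_oSwap (k : Fin d) (o : Orient d) : oSwap (L := L) k (oSwap (L := L) k o) = o := by
  have h := congrArg Prod.snd (plaqSwap_plaqSwap (L := L) 0 k ((fun _ => 0), o))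
  rw [plaqSwap_snd] at h
  exact h

omit [NeZero L] in
/-- The plaquette set of the axis-exchanged family is the axis-exchanged plaquette set. -/
theorem plaqs_swap (k : Fin d) (A : Orient d → Finset (BlockIdx d L)) :
    plaqs (fun o => (A (oSwap (L := L) k o)).image (swapIdx k)) = (plaqs A).image (plaqSwap 0 k) := by
  rw [plaqs, plaqs, biUnion_image]
  ext q
  simp only [mem_biUnion, mem_univ, true_and]
  constructor
  · rintro ⟨o, h⟩
    refine ⟨oSwap (L := L) k o, ?_⟩
    rw [← image_toPlaq_image_swapIdx, oSwap_oSwap]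
    exact h
  · rintro ⟨o, h⟩
    refine ⟨oSwap (L := L) k o, ?_⟩
    rw [← image_toPlaq_image_swapIdx] at h
    rw [oSwap_oSwap]
    exact h

omit [NeZero d] in
/-- The plaquette set of the full family is every plaquette. -/
theorem plaqs_top : plaqs (fun _ : Orient d => (univ : Finset (BlockIdx d L))) = univ := by
  ext q
  simp only [mem_plaqs, mem_univ, true_and, iff_true]
  exact ⟨_, toPlaq_surj q.2 rfl⟩

omit [NeZero d] [NeZero L] in
/-- The cardinality of `plaqs A` is the total size of the family. -/
theorem card_plaqs (A : Orient d → Finset (BlockIdx d L)) : #(plaqs A) = ∑ o, #(A o) := by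
  rw [plaqs, card_biUnion]
  · exact sum_congr rfl fun o _ => card_image_of_injective _ (toPlaq_injective o)
  · intro o _ o' _ hoo'
    rw [Function.onFun, Finset.disjoint_left]
    intro q hq hq'
    obtain ⟨c, -, rfl⟩ := mem_image.1 hq
    obtain ⟨c', -, h⟩ := mem_image.1 hq'
    exact hoo' (by simpa using (congrArg Prod.snd h).symm)

omit [NeZero d] [NeZero L] in
/-- Every finite set of plaquettes is `plaqs` of a family of the same total size. -/
theorem exists_plaqs_eq (P : Finset (Plaquette d L)) :
    ∃ A : Orient d → Finset (BlockIdx d L), plaqs A = P ∧ ∑ o, #(A o) = #P := by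
  classical
  choose A hA hcard using fun o : Orient d =>
    exists_image_toPlaq_eq o (P.filter fun q => q.2 = o) fun q hq => (mem_filter.1 hq).2
  have hP : plaqs A = P := by
    ext q
    rw [mem_plaqs]
    constructor
    · rintro ⟨c, hc, hq⟩
      have : q ∈ (A q.2).image (toPlaq q.2) := mem_image.2 ⟨c, hc, hq⟩
      rw [hA] at this
      exact (mem_filter.1 this).1
    · intro hq
      have : q ∈ (A q.2).image (toPlaq q.2) := by rw [hA]; exact mem_filter.2 ⟨hq, rfl⟩
      obtain ⟨c, hc, h⟩ := mem_image.1 this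
      exact ⟨c, hc, h⟩
  refine ⟨A, hP, ?_⟩
  rw [← card_plaqs, hP]

end Plaqs

/-! ### §2. The multi-orientation chessboard functional -/

/-- **The chessboard functional of a family of patterns**: `Ψ(A) = ⟨exp(c ∑_{q ∈ plaqs A} φ_q)⟩_{Λ,β}`. -/
def mpsi (β c : ℝ) (A : Orient d → Finset (BlockIdx d L)) : ℝ :=
  wilsonExpectation ρ β (expObs (G := G) ρ c (plaqs A))

omit [NeZero d] in
/-- `Ψ ≥ 0`. -/
theorem mpsi_nonneg (β c : ℝ) (A : Orient d → Finset (BlockIdx d L)) : 0 ≤ mpsi (G := G) ρ β c A :=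
  wilsonExpectation_expObs_nonneg ρ β c _

omit [NeZero d] in
/-- **Monotonicity of the Chebyshev functional in the plaquette set** (`c ≥ 0`: every plaquette cost is `≥ 0`). -/
theorem wilsonExpectation_expObs_mono (hρ : Continuous ρ) {c : ℝ} (hc : 0 ≤ c) (β : ℝ)
    {P Q : Finset (Plaquette d L)} (hPQ : P ⊆ Q) :
    wilsonExpectation ρ β (expObs (G := G) ρ c P) ≤ wilsonExpectation ρ β (expObs (G := G) ρ c Q) := by
  have hρN : ∀ g : G, (ρ g).trace.re ≤ N := fun g => by
    have h := Literature.RepresentationTheory.CompactGroups.CompactGroup.abs_re_trace_le_card ρ hρ g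
    simp only [Fintype.card_fin] at h
    exact (le_abs_self _).trans h
  obtain ⟨CP, hCP⟩ := exists_abs_expObs_le (G := G) ρ hρ c P
  obtain ⟨CQ, hCQ⟩ := exists_abs_expObs_le (G := G) ρ hρ c Q
  unfold wilsonExpectation
  refine integral_mono (integrable_wilsonMeasure_of_abs_le ρ hρ β (measurable_expObs ρ hρ c P) hCP)
    (integrable_wilsonMeasure_of_abs_le ρ hρ β (measurable_expObs ρ hρ c Q) hCQ) fun U => ?_
  unfold expObs
  exact Real.exp_le_exp.2 (mul_le_mul_of_nonneg_left
    (sum_le_sum_of_subset_of_nonneg hPQ fun q _ _ => plaquetteCost_nonneg ρ hρN _ _ _ U) hc)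

omit [NeZero d] in
/-- `⟨exp(c ∑_{q ∈ P} φ_q)⟩ ≥ 1` for `c ≥ 0`. -/
theorem one_le_wilsonExpectation_expObs (hρ : Continuous ρ) (β : ℝ) {c : ℝ} (hc : 0 ≤ c)
    (P : Finset (Plaquette d L)) : 1 ≤ wilsonExpectation ρ β (expObs (G := G) ρ c P) := by
  haveI := isProbabilityMeasure_wilsonMeasure (d := d) (L := L) (G := G) ρ hρ β
  have h := wilsonExpectation_expObs_mono (G := G) ρ hρ hc β (empty_subset P)
  have h0 : wilsonExpectation ρ β (expObs (G := G) ρ c (∅ : Finset (Plaquette d L))) = 1 := by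
    unfold wilsonExpectation; simp [expObs]
  rwa [h0] at h

omit [NeZero d] in
/-- **Translation invariance** of `Ψ` under the diagonal block translations. -/
theorem mpsi_translate (β c : ℝ) (k : Fin d) (a : ZMod L) (A : Orient d → Finset (BlockIdx d L)) :
    mpsi (G := G) ρ β c (fun o => (A o).image (cellTranslate k a)) = mpsi ρ β c A := by
  unfold mpsi
  rw [plaqs_translate, wilsonExpectation_expObs_plaqTranslate]

/-- **Axis-exchange invariance** of `Ψ`. -/
theorem mpsi_swap (hρ : Continuous ρ) (β c : ℝ) (k : Fin d) (A : Orient d → Finset (BlockIdx d L)) :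
    mpsi (G := G) ρ β c (fun o => (A (oSwap (L := L) k o)).image (swapIdx k)) = mpsi ρ β c A := by
  unfold mpsi
  rw [plaqs_swap, wilsonExpectation_expObs_swap ρ hρ]

end Summit.QuantumFields.YangMills.Theorems.AllSidesChessboard

end
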